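import Summits.CriticalPhenomena.PercolationContinuityZ3.Theorems.Transplant.Slab111HubShapeLink
import Summits.CriticalPhenomena.PercolationContinuityZ3.Theorems.Transplant.Slab111HubTab4
import HarnessLib

/-!
# The HUB ROUTING of the `(111)`-films, XXV: `linkage_of_shape4` — the swap pair at a block of a valid shape from v4 tables (class rule)

builds on p205010 (kernel theorem, internal audit signed; external expert review pending) — NOT used in this file.  Lane `prim-bschramm`, seat
`prim-bschramm-p2` (gen 36; class C1b; memo `HOME/bschramm/P2-LATTICES.md` §131); helper file (`--supports stmt-CriticalPhenomena-4575 --as helper`).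
**`linkage_of_shape4`**: «Slab111HubShapeLink».`linkage_of_shape` for tables checked by «Slab111HubTab4».`tab4OK` (the class rule
for tight pairs discharged from the terminals' admissibility, `classOKB_of_levels`); the generic form of «Slab111HubU19».`linkage_U19` — for `k ≥ 51`, a shape `S` («Slab111HubShape».`ShapeB`) valid for the
block type `(t_R, t_D, s_R, s_D)` (`ShapeB.Valid`) and its kernel tables (`tab3OK S.pcB S.colsB S.badG S.filtG S.cols q₁ q₂ A C` for all cleared
columns `q₁, q₂`), the cleared set `WOf S k z` carries a swap pair for every certified terminal triple.  The remaining block types of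
`ShapedLinkage 3` are instances (shape files + table files).
[cite: DuminilCopinSidoraviciusTassion2016, §2.3 (proof of Fact 2: the three disjoint paths γ_u, γ_v, γ_w in B_R(z))]
-/

noncomputable section

namespace Summit.CriticalPhenomena.PercolationContinuityZ3.Theorems.Transplant

open Literature.Probability.Percolation Literature.Probability.LatticeModels SimpleGraph
open scoped Classical

namespace Slab111

variable {k : ℕ}

/-- The class rule holds for two film vertices. [folklore] -/
theorem classOKB_of_levels {c0 nI nJ : ℤ} {qI qJ : ℤ × ℤ} (hI : (3 : ℤ) ∣ nI - c0 - (qI.1 + 2 * qI.2)) (hJ : (3 : ℤ) ∣ nJ - c0 - (qJ.1 + 2 * qJ.2)) :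
    classOKB qI qJ (clampτ (nJ - nI)) = true := by
  unfold classOKB
  rw [Bool.or_eq_true, Bool.or_eq_true, beq_iff_eq, beq_iff_eq, beq_iff_eq]
  rcases clampτ_cases (nJ - nI) with ⟨-, e⟩ | ⟨-, e⟩ | ⟨-, -, e⟩ <;> rw [e]
  · exact Or.inl (Or.inl rfl)
  · exact Or.inl (Or.inr rfl)
  · right
    have h : (3 : ℤ) ∣ nJ - nI - ((qJ.1 + 2 * qJ.2) - (qI.1 + 2 * qI.2)) := by
      have := dvd_sub hJ hI
      have e' : nJ - nI - ((qJ.1 + 2 * qJ.2) - (qI.1 + 2 * qI.2)) = (nJ - c0 - (qJ.1 + 2 * qJ.2)) - (nI - c0 - (qI.1 + 2 * qI.2)) := by ring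
      rw [e']; exact this
    exact Int.emod_eq_zero_of_dvd h

set_option maxHeartbeats 4000000 in
/-- **THE SWAP PAIR AT A BLOCK OF A VALID SHAPE** (`k ≥ 51`), given the shape's v4 dispatcher tables. [folklore] -/
theorem linkage_of_shape4 (hk : 51 ≤ k) {S : ShapeB} {tR tD sR sD : ℕ} (hV : S.Valid tR tD sR sD)
    (htab : ∀ q₁ ∈ S.cols, q₁ ≠ (0, 0) → S.pcB q₁ = true → ∀ q₂ ∈ S.cols, q₂ ≠ (0, 0) → S.pcB q₂ = true →
      ∃ A C : ℕ, tab4OK S.pcB S.colsB S.badG S.filtG S.cols q₁ q₂ A C = true) (z : Site 2) :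
    ∃ W : Set (slab111 k), (∀ x ∈ W, (hexShadow k).sh x ∈ blkR 3 z tD sD) ∧
      (∀ x, (hexShadow k).sh x ∈ hexBall z 1 → (hexShadow k).sh x ∈ blkR 3 z tD sD → x ∈ W) ∧
      ∀ (E₁ E₂ w' : slab111 k), (hexShadow k).Terminals 3 z tR tD sR W E₁ E₂ w' →
        ∃ r₁ r₂ : VRouteData (film k) (W ∩ (hexShadow k).lift (blkR 3 z tR sR)) W E₁ E₂ w', r₁.y = r₂.b ∧ r₁.b = r₂.y := by
  refine ⟨WOf S k z, WOf_subset_blkR hV z, fun x h1 hD => mem_WOf_of_hexBall_one hV z x h1 hD, ?_⟩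
  intro E₁ E₂ w' hT
  have hkZ : (51 : ℤ) ≤ k := by exact_mod_cast hk
  have hPRW : WOf S k z ∩ (hexShadow k).lift (blkR 3 z tR sR) ⊆ WOf S k z := Set.inter_subset_left
  have hz : (3 : ℤ) ∣ z 0 + 2 * z 1 - (z 0 + 2 * z 1) := dvd_cls_self z
  -- terminal data
  obtain ⟨hq1, hs1, h01, hk1⟩ := member_factsG hT.E₁W
  obtain ⟨hq2, hs2, h02, hk2⟩ := member_factsG hT.E₂W
  obtain ⟨hq3, hs3, h03, hk3⟩ := member_factsG hT.w'W
  have hR1 : inBlkB tR sR (relC z E₁) = true := by have := hT.E₁R; rw [hexShadow_sh, sh_mem_blkR_iff] at this; exact this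
  have hR2 : inBlkB tR sR (relC z E₂) = true := by have := hT.E₂R; rw [hexShadow_sh, sh_mem_blkR_iff] at this; exact this
  have hP1 : S.pcB (relC z E₁) = true := (hV.pcR _).2 ⟨hq1, hR1⟩
  have hP2 : S.pcB (relC z E₂) = true := (hV.pcR _).2 ⟨hq2, hR2⟩
  have hE1 : sh E₁ = vcol z (relC z E₁) ∧ lev (E₁ : Site 3) = lev (E₁ : Site 3) := ⟨hs1, rfl⟩
  have hE2 : sh E₂ = vcol z (relC z E₂) ∧ lev (E₂ : Site 3) = lev (E₂ : Site 3) := ⟨hs2, rfl⟩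
  have hE3 : sh w' = vcol z (relC z w') ∧ lev (w' : Site 3) = lev (w' : Site 3) := ⟨hs3, rfl⟩
  have hE1P : E₁ ∈ WOf S k z ∩ (hexShadow k).lift (blkR 3 z tR sR) := mem_PR_of hT.E₁W hR1
  have hE2P : E₂ ∈ WOf S k z ∩ (hexShadow k).lift (blkR 3 z tR sR) := mem_PR_of hT.E₂W hR2
  have hq10 : relC z E₁ ≠ (0, 0) := fun e => hT.E₁z (show sh E₁ = z by rw [hs1, e, vcol_zero])
  have hq20 : relC z E₂ ≠ (0, 0) := fun e => hT.E₂z (show sh E₂ = z by rw [hs2, e, vcol_zero])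
  have hq30 : relC z w' ≠ (0, 0) := fun e => hT.w'z (show sh w' = z by rw [hs3, e, vcol_zero])
  have hw1 : sh w' ≠ sh E₁ := hT.w'E₁
  have hw2 : sh w' ≠ sh E₂ := hT.w'E₂
  have hq31 : relC z w' ≠ relC z E₁ := relC_ne_of_sh_ne hw1
  have hq32 : relC z w' ≠ relC z E₂ := relC_ne_of_sh_ne hw2
  have hne12 : (relC z E₁, lev (E₁ : Site 3)) ≠ (relC z E₂, lev (E₂ : Site 3)) := by
    intro e; simp only [Prod.mk.injEq] at e
    exact hT.ne (eq_of_sh_eq_of_lev_eq (by rw [hs1, hs2, e.1]) e.2)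
  have hne13 : (relC z E₁, lev (E₁ : Site 3)) ≠ (relC z w', lev (w' : Site 3)) := by
    intro e; simp only [Prod.mk.injEq] at e; exact hq31 e.1.symm
  have hne23 : (relC z E₂, lev (E₂ : Site 3)) ≠ (relC z w', lev (w' : Site 3)) := by
    intro e; simp only [Prod.mk.injEq] at e; exact hq32 e.1.symm
  have hcl1 := cls_of_sh_lev hz hE1
  have hcl2 := cls_of_sh_lev hz hE2
  have hcl3 := cls_of_sh_lev hz hE3
  -- the zone
  obtain ⟨Hlo, hH, hH2, hHk, hc1, hc2, hc3⟩ :=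
    zone_exists (z 0 + 2 * z 1) (Λ := 3) (k := k) (by norm_num) (by omega) ⟨h01, hk1⟩ ⟨h02, hk2⟩ ⟨h03, hk3⟩
  have hd1 := dirOfLevel_eq 3 Hlo (lev (E₁ : Site 3))
  have hd2 := dirOfLevel_eq 3 Hlo (lev (E₂ : Site 3))
  have hd3 := dirOfLevel_eq 3 Hlo (lev (w' : Site 3))
  -- the terminal rules
  obtain ⟨o₁, a₁, a₂, o₂, hoE1, hEa1, haE2, hEo2, ho1, ho2, hwo1, hwa1w, hwa2w, hwo2, ha1o1, ha1E2, ha2o2, ha2E1, -, -, -, -, -, hwa1, hwa2, -⟩ :=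
    hT.nbrs
  have hwa1' : sh a₁ ≠ sh w' := fun e => hwa1 e.symm
  have hwa2' : sh a₂ ≠ sh w' := fun e => hwa2 e.symm
  have hX1 := ruleXG_of_terminal hV hH2 hHk hc1 ho1 hwo1 hoE1.symm
  have hX2 := ruleXG_of_terminal hV hH2 hHk hc2 ho2 hwo2 hEo2
  have hRR1 : S.ruleR2G (relC z E₁) (relC z E₂) (relC z w') (dirOfLevel 3 Hlo (lev (E₁ : Site 3))) (dirOfLevel 3 Hlo (lev (E₂ : Site 3)))
      (βOf k (dirOfLevel 3 Hlo (lev (E₁ : Site 3))) (lev (E₁ : Site 3))) (βOf k (dirOfLevel 3 Hlo (lev (E₂ : Site 3))) (lev (E₂ : Site 3))) =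
      true := by
    by_cases hβ : βOf k (dirOfLevel 3 Hlo (lev (E₁ : Site 3))) (lev (E₁ : Site 3)) = 0
    · exact ruleR2G_of_terminal hV (by omega) hβ ho1 hwo1 hwa1w hoE1 hEa1 ha1o1 ha1E2 hwa1' hd2 ⟨h02, hk2⟩
    · unfold ShapeB.ruleR2G; simp [hβ]
  have hRR2 : S.ruleR2G (relC z E₂) (relC z E₁) (relC z w') (dirOfLevel 3 Hlo (lev (E₂ : Site 3))) (dirOfLevel 3 Hlo (lev (E₁ : Site 3)))
      (βOf k (dirOfLevel 3 Hlo (lev (E₂ : Site 3))) (lev (E₂ : Site 3))) (βOf k (dirOfLevel 3 Hlo (lev (E₁ : Site 3))) (lev (E₁ : Site 3))) =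
      true := by
    by_cases hβ : βOf k (dirOfLevel 3 Hlo (lev (E₂ : Site 3))) (lev (E₂ : Site 3)) = 0
    · exact ruleR2G_of_terminal hV (by omega) hβ ho2 hwo2 hwa2w hEo2.symm haE2.symm ha2o2 ha2E1 hwa2' hd1 ⟨h01, hk1⟩
    · unfold ShapeB.ruleR2G; simp [hβ]
  -- the entry of the table
  obtain ⟨A, C, htabq⟩ := htab _ (hV.colsList _ hq1) hq10 hP1 _ (hV.colsList _ hq2) hq20 hP2
  have hfilt : S.filtG (relC z E₁) (relC z E₂) (relC z w') (dirOfLevel 3 Hlo (lev (E₁ : Site 3))) (dirOfLevel 3 Hlo (lev (E₂ : Site 3)))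
      (dirOfLevel 3 Hlo (lev (w' : Site 3))) (βOf k (dirOfLevel 3 Hlo (lev (E₁ : Site 3))) (lev (E₁ : Site 3)))
      (βOf k (dirOfLevel 3 Hlo (lev (E₂ : Site 3))) (lev (E₂ : Site 3))) (βOf k (dirOfLevel 3 Hlo (lev (w' : Site 3))) (lev (w' : Site 3))) =
      true := by
    have c1 := fun h => badG_of_flag (S := S) (Hlo := Hlo) hT.E₁W h
    have c2 := fun h => badG_of_flag (S := S) (Hlo := Hlo) hT.E₂W h
    have c3 := fun h => badG_of_flag (S := S) (Hlo := Hlo) hT.w'W h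
    unfold ShapeB.filtG
    simp only [hX1, hX2, hRR1, hRR2, Bool.and_true, Bool.and_eq_true, Bool.not_eq_true', Bool.and_eq_false_iff, and_assoc]
    refine ⟨?_, ?_, ?_⟩
    · by_cases h : βOf k (dirOfLevel 3 Hlo (lev (E₁ : Site 3))) (lev (E₁ : Site 3)) = 0
      · exact Or.inr (c1 h)
      · left; rw [beq_eq_false_iff_ne]; exact h
    · by_cases h : βOf k (dirOfLevel 3 Hlo (lev (E₂ : Site 3))) (lev (E₂ : Site 3)) = 0
      · exact Or.inr (c2 h)
      · left; rw [beq_eq_false_iff_ne]; exact h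
    · by_cases h : βOf k (dirOfLevel 3 Hlo (lev (w' : Site 3))) (lev (w' : Site 3)) = 0
      · exact Or.inr (c3 h)
      · left; rw [beq_eq_false_iff_ne]; exact h
  obtain ⟨e, hbase, hacc1, hacc2, hacc3, hp12, hp13, hp23⟩ := tab4OK_sound htabq (hV.colsList _ hq3) hq30 hq31 hq32 hd1 hd2 hd3
    (βOf_lt _ _ _) (βOf_lt _ _ _) (βOf_lt _ _ _) hfilt
    (clampτ_mem_TAUS _) (clampτ_mem_TAUS _) (clampτ_mem_TAUS _)
    (fun hd => by rw [← hd]; exact pairRuleB_of_levels hd1 ⟨h01, hk1⟩ ⟨h02, hk2⟩ hne12)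
    (fun hd => by rw [← hd]; exact pairRuleB_of_levels hd1 ⟨h01, hk1⟩ ⟨h03, hk3⟩ hne13)
    (fun hd => by rw [← hd]; exact pairRuleB_of_levels hd2 ⟨h02, hk2⟩ ⟨h03, hk3⟩ hne23)
    (fun _ _ => maybeB_of_levels _ _ _)
    (fun _ => classOKB_of_levels hcl1 hcl2) (fun _ => classOKB_of_levels hcl1 hcl3) (fun _ => classOKB_of_levels hcl2 hcl3)
  have hok0 := Entry.ok2_of_baseB (Pc := S.cols.filter fun c => S.pcB c) (Wc := S.cols.filter fun c => S.colsB c)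
    (fun c hc => List.mem_filter.2 ⟨hV.colsList _ ((hV.pcR _).1 hc).1, hc⟩) (fun c hc => List.mem_filter.2 ⟨hV.colsList _ hc, hc⟩) hbase
  have hok0' := hok0
  obtain ⟨-, -, -, -, -, -, -, -, -, -, -, -, -, -, -, -, hL1, hL2, hL3, -⟩ := hok0'
  -- the pairs
  obtain ⟨a21, a12, t21, t12, f12⟩ := pair_pack hc1 hc2 hp12
  obtain ⟨a31, a13, t31, t13, f13⟩ := pair_pack hc1 hc3 hp13
  obtain ⟨a32, a23, t32, t23, f23⟩ := pair_pack hc2 hc3 hp23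
  have hok := Entry.ok2_of_base hok0 a21 a31 a12 a32 a13 a23
  -- the hub levels
  set d₁ := dirOfLevel 3 Hlo (lev (E₁ : Site 3)) with hd₁def
  set LA := laOf Hlo d₁ with hLAdef
  set LD := ldOf Hlo d₁ with hLDdef
  obtain ⟨hLA, hLD, hmin, hmax⟩ := laOf_spec hH hd1
  have hLA2 : 2 ≤ LA := by rw [hLAdef]; unfold laOf; split_ifs <;> omega
  have hLAk : LA ≤ (k : ℤ) - 2 := by rw [hLAdef]; unfold laOf; split_ifs <;> omega
  have hLD2 : 2 ≤ LD := by rw [hLDdef]; unfold ldOf; split_ifs <;> omega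
  have hLDk : LD ≤ (k : ℤ) - 2 := by rw [hLDdef]; unfold ldOf; split_ifs <;> omega
  have hz1 : (d₁ = 1 → lev (E₁ : Site 3) + 3 + 2 ≤ min LA LD) ∧ (d₁ = -1 → max LA LD + 3 + 2 ≤ lev (E₁ : Site 3)) := by
    rw [hmin, hmax]; exact dir_margin hc1
  have hz2 : (dirOfLevel 3 Hlo (lev (E₂ : Site 3)) = 1 → lev (E₂ : Site 3) + 3 + 2 ≤ min LA LD) ∧
      (dirOfLevel 3 Hlo (lev (E₂ : Site 3)) = -1 → max LA LD + 3 + 2 ≤ lev (E₂ : Site 3)) := by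
    rw [hmin, hmax]; exact dir_margin hc2
  have hz3 : (dirOfLevel 3 Hlo (lev (w' : Site 3)) = 1 → lev (w' : Site 3) + 3 + 2 ≤ min LA LD) ∧
      (dirOfLevel 3 Hlo (lev (w' : Site 3)) = -1 → max LA LD + 3 + 2 ≤ lev (w' : Site 3)) := by
    rw [hmin, hmax]; exact dir_margin hc3
  -- separations with the hub levels in place of the zone ends
  have s21 : xbOf Hlo (lev (E₁ : Site 3)) (lev (E₂ : Site 3)) = true ∨ lev (E₁ : Site 3) + 3 < min (lev (E₂ : Site 3) - 3) (min LA LD - 1) ∨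
      max (lev (E₂ : Site 3) + 3) (max LA LD + 1) < lev (E₁ : Site 3) - 3 ∨ LocSep e.l₁ e.l₂ (relC z E₁) e.F2 d₁ (lev (E₁ : Site 3)) (lev (E₂ : Site 3)) := by
    rw [hmin, hmax]; exact t21
  have s12 : xbOf Hlo (lev (E₂ : Site 3)) (lev (E₁ : Site 3)) = true ∨ lev (E₂ : Site 3) + 3 < min (lev (E₁ : Site 3) - 3) (min LA LD - 1) ∨
      max (lev (E₁ : Site 3) + 3) (max LA LD + 1) < lev (E₂ : Site 3) - 3 ∨
      LocSep e.l₂ e.l₁ (relC z E₂) e.F1 (dirOfLevel 3 Hlo (lev (E₂ : Site 3))) (lev (E₂ : Site 3)) (lev (E₁ : Site 3)) := by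
    rw [hmin, hmax]; exact t12
  have s31 : xbOf Hlo (lev (E₁ : Site 3)) (lev (w' : Site 3)) = true ∨ lev (E₁ : Site 3) + 3 < min (lev (w' : Site 3) - 3) (min LA LD - 1) ∨
      max (lev (w' : Site 3) + 3) (max LA LD + 1) < lev (E₁ : Site 3) - 3 ∨ LocSep e.l₁ e.l₃ (relC z E₁) e.F3 d₁ (lev (E₁ : Site 3)) (lev (w' : Site 3)) := by
    rw [hmin, hmax]; exact t31
  have s13 : xbOf Hlo (lev (w' : Site 3)) (lev (E₁ : Site 3)) = true ∨ lev (w' : Site 3) + 3 < min (lev (E₁ : Site 3) - 3) (min LA LD - 1) ∨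
      max (lev (E₁ : Site 3) + 3) (max LA LD + 1) < lev (w' : Site 3) - 3 ∨
      LocSep e.l₃ e.l₁ (relC z w') e.F1 (dirOfLevel 3 Hlo (lev (w' : Site 3))) (lev (w' : Site 3)) (lev (E₁ : Site 3)) := by
    rw [hmin, hmax]; exact t13
  have s32 : xbOf Hlo (lev (E₂ : Site 3)) (lev (w' : Site 3)) = true ∨ lev (E₂ : Site 3) + 3 < min (lev (w' : Site 3) - 3) (min LA LD - 1) ∨
      max (lev (w' : Site 3) + 3) (max LA LD + 1) < lev (E₂ : Site 3) - 3 ∨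
      LocSep e.l₂ e.l₃ (relC z E₂) e.F3 (dirOfLevel 3 Hlo (lev (E₂ : Site 3))) (lev (E₂ : Site 3)) (lev (w' : Site 3)) := by
    rw [hmin, hmax]; exact t32
  have s23 : xbOf Hlo (lev (w' : Site 3)) (lev (E₂ : Site 3)) = true ∨ lev (w' : Site 3) + 3 < min (lev (E₂ : Site 3) - 3) (min LA LD - 1) ∨
      max (lev (E₂ : Site 3) + 3) (max LA LD + 1) < lev (w' : Site 3) - 3 ∨
      LocSep e.l₃ e.l₂ (relC z w') e.F2 (dirOfLevel 3 Hlo (lev (w' : Site 3))) (lev (w' : Site 3)) (lev (E₂ : Site 3)) := by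
    rw [hmin, hmax]; exact t23
  -- membership of the low leg vertices
  have hCP : ∀ c ∈ S.cols.filter (fun c => S.pcB c), S.colsB c = true := fun c hc => ((hV.pcR _).1 (List.mem_filter.1 hc).2).1
  have hCW : ∀ c ∈ S.cols.filter (fun c => S.colsB c), S.colsB c = true := fun c hc => (List.mem_filter.1 hc).2
  have hm1 := low_memG (z := z) hz hH2 hHk hCP ⟨h01, hk1⟩ hcl1 hc1 hL1 hacc1
  have hm2 := low_memG (z := z) hz hH2 hHk hCP ⟨h02, hk2⟩ hcl2 hc2 hL2 hacc2
  have hm3 := low_memG (z := z) hz hH2 hHk hCW ⟨h03, hk3⟩ hcl3 hc3 hL3 hacc3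
  -- membership in `PR` of a vertex over a region column
  have memPR : ∀ {q : ℤ × ℤ} {L : ℤ}, S.pcB q = true → Adm k (vcol z q) L → vl k (vcol z q) L ∈ WOf S k z →
      vl k (vcol z q) L ∈ WOf S k z ∩ (hexShadow k).lift (blkR 3 z tR sR) := by
    intro q L hq hadm hm
    refine ⟨hm, ?_⟩
    rw [HexShadow.mem_lift, hexShadow_sh, sh_mem_blkR_iff, relC_vl hadm]
    exact ((hV.pcR _).1 hq).2
  obtain ⟨-, -, -, -, -, -, -, -, -, -, -, -, -, -, -, -, hF1, hF2, hF3, -⟩ := hok0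
  exact Entry.swap2 e hz hPRW
    (fun q hq L h1 hk' hd => memPR (List.mem_filter.1 hq).2 (adm_vcol hz (by omega) (by omega) hd) (vl_mem_WOf hz (hCP q hq) h1 hk' hd))
    (fun q hq L h1 hk' hd => vl_mem_WOf hz (hCW q hq) h1 hk' hd)
    hE1 hE2 hE3 hE1P hE2P hT.w'W hT.ne ⟨h01, hk1⟩ ⟨h02, hk2⟩ ⟨h03, hk3⟩ hd1 hd2 hd3 (by norm_num) hok
    (fun p hp hp0 hlow => let ⟨hr, hadm, hm⟩ := hm1 p hp hp0 hlow
      ⟨hr, memPR (List.mem_filter.1 ((hF1.2.2.2.2.2 p hp hp0).1)).2 hadm hm⟩)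
    (fun p hp hp0 hlow => let ⟨hr, hadm, hm⟩ := hm2 p hp hp0 hlow
      ⟨hr, memPR (List.mem_filter.1 ((hF2.2.2.2.2.2 p hp hp0).1)).2 hadm hm⟩)
    (fun p hp hp0 hlow => let ⟨hr, _, hm⟩ := hm3 p hp hp0 hlow; ⟨hr, hm⟩)
    hLA hLD hLA2 hLAk hLD2 hLDk hz1 hz2 hz3 f12 f13 f23 s21 s31 s12 s32 s13 s23

end Slab111

end Summit.CriticalPhenomena.PercolationContinuityZ3.Theorems.Transplant

end
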